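import Summits.FinalStateConjecture.FinalStateConjecture.Theorems.ZeroEnergyRigidity.Negative.MinkowskiPresentation
import Literature.Geometry.Lorentzian.IPlusRegular
import Literature.Geometry.Lorentzian.MinkowskiGlobalHyperbolicity
import Literature.Geometry.Lorentzian.MinkowskiCauchy
import Literature.Geometry.Lorentzian.ExtensionProofs

/-!
# The horizonless Minkowski `StationaryAFBlackHole` is `I⁺`-regular (and analytic)

Negative lane of the crux `ZeroEnergyRigidity` (stmt-FinalStateConjecture-10690), cdisprove cycle 4,
companion of `MinkowskiPresentation.lean` / `MinkowskiNoHorizon.lean`.  The presentation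
`minkowskiBH` of Minkowski spacetime (empty future event horizon, `doc = ℝ⁴`) satisfies
Chruściel–Costa's `I⁺`-regularity (Def. 1.1, tree predicate `StationaryAFBlackHole.IsIPlusRegular`):
Minkowski spacetime is strongly causal with compact causal diamonds (`minkowski_isStronglyCausalAt`,
`Minkowski.isCompact_causalFuture_inter_causalPast`), and the slice `{t = 0}` is a hypersurface as in
Def. 1.1 — spacelike, connected, acausal, closed (so `∂S̄ = ∅ ⊆ 𝓔⁺ = ∅`, trivially a cross-section),
the union of the compact unit ball and the end `{‖y‖ > 1}`, and a topological manifold with EMPTY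
boundary in the half-space atlas `x ↦ (e^{x¹}, x², x³)` (`minkowskiHypersurface`).  It is also
analytic (`isAnalytic_minkowskiBH`).  Consequence (in `MinkowskiNotKerr.lean`): every uniqueness /
rigidity schema over `StationaryAFBlackHole` that keeps `I⁺`-regularity, analyticity, vacuum and
non-degeneracy but DROPS `IsConnected 𝓑.horizon` is false — the restate of the crux must keep h2.

References: P. T. Chruściel, J. L. Costa, Astérisque 321 (2008), Def. 1.1; B. O'Neill,
*Semi-Riemannian geometry* (1983), Ch. 14, Def. 14.11 (strong causality), p. 402 (`J⁺` in `ℝ⁴₁`).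
-/

noncomputable section

namespace Summit.FinalStateConjecture.FinalStateConjecture.Theorems.ZeroEnergyRigidity.Negative

open Set Function Metric Literature.Geometry.Lorentzian
open scoped Manifold ContDiff Topology

-- Minkowski metric / time orientation with carrier syntactically `E4` (see `MinkowskiPresentation`).
local notation "η₄" => (LorentzianMetric.ofLE (n' := (∞ : ℕ∞ω)) Minkowski.metric le_top)
local notation "∂ₜ" => (TimeOrientation.ofLE (n' := (∞ : ℕ∞ω)) Minkowski.timeOrientation le_top)

/-! ## Strong causality of Minkowski spacetime -/

/-- **Minkowski spacetime is strongly causal at every point**: a future causal curve with both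
endpoints in the ball `B(p, ε/8)` stays in `B(p, ε)`, because along it the time coordinate is
monotone and the spatial displacement is bounded by the elapsed time
(`Minkowski.norm_spatial_sub_le_of_isFutureCausalCurveOn`). [cite: ONeillSemiRiemannian1983, Ch. 14, Def. 14.11 and p. 402] -/
theorem minkowski_isStronglyCausalAt (p : E4) : LorentzianMetric.IsStronglyCausalAt η₄ ∂ₜ p := by
  intro U hU
  obtain ⟨ε, hε, hball⟩ := Metric.mem_nhds_iff.mp hU
  refine ⟨ball p (ε / 8), ball_mem_nhds p (by positivity),
    (ball_subset_ball (by linarith)).trans hball, ?_⟩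
  intro γ a b hab hγ ha hb t ht
  apply hball
  rw [mem_ball, dist_eq_norm] at ha hb ⊢
  have h1 := Minkowski.norm_spatial_sub_le_of_isFutureCausalCurveOn ordConnected_Icc hγ
    (left_mem_Icc.2 hab.le) ht ht.1
  have h2 := Minkowski.norm_spatial_sub_le_of_isFutureCausalCurveOn ordConnected_Icc hγ
    ht (right_mem_Icc.2 hab.le) ht.2
  have ha0 : |(γ a - p) 0| ≤ ‖γ a - p‖ := C0Extension.abs_apply_zero_le_norm _
  have hb0 : |(γ b - p) 0| ≤ ‖γ b - p‖ := C0Extension.abs_apply_zero_le_norm _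
  have has : ‖E4.spatial (γ a - p)‖ ≤ ‖γ a - p‖ := C0Extension.norm_spatial_le_norm _
  have hle : ‖γ t - p‖ ≤ |(γ t - p) 0| + ‖E4.spatial (γ t - p)‖ :=
    C0Extension.norm_le_abs_add_norm_spatial _
  simp only [PiLp.sub_apply, map_sub] at ha0 hb0 has hle
  have hsp : ‖E4.spatial (γ t) - E4.spatial p‖ ≤
      ‖E4.spatial (γ t) - E4.spatial (γ a)‖ + ‖E4.spatial (γ a) - E4.spatial p‖ :=
    norm_sub_le_norm_sub_add_norm_sub _ _ _
  have h0 : |γ t 0 - p 0| ≤ |γ a 0 - p 0| + |γ b 0 - p 0| + 0 := by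
    rcases le_total (γ t 0) (p 0) with h | h
    · rw [abs_of_nonpos (by linarith)]
      have : γ a 0 - p 0 ≤ γ t 0 - p 0 := by linarith [norm_nonneg (E4.spatial (γ t) - E4.spatial (γ a))]
      linarith [neg_abs_le (γ a 0 - p 0), abs_nonneg (γ b 0 - p 0)]
    · rw [abs_of_nonneg (by linarith)]
      have : γ t 0 - p 0 ≤ γ b 0 - p 0 := by linarith [norm_nonneg (E4.spatial (γ b) - E4.spatial (γ t))]
      linarith [le_abs_self (γ b 0 - p 0), abs_nonneg (γ a 0 - p 0)]
  have hspan : ‖E4.spatial (γ t) - E4.spatial (γ a)‖ ≤ |γ a 0 - p 0| + |γ b 0 - p 0| := by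
    have : γ t 0 - γ a 0 ≤ |γ b 0 - p 0| + |γ a 0 - p 0| := by
      have hbt : γ t 0 ≤ γ b 0 := by linarith [norm_nonneg (E4.spatial (γ b) - E4.spatial (γ t))]
      linarith [le_abs_self (γ b 0 - p 0), neg_abs_le (γ a 0 - p 0)]
    linarith
  linarith

/-! ## The slice `{t = 0}`: closed, acausal, spacelike -/

/-- The range of the slice embedding is the closed hyperplane `{x⁰ = 0}`. [folklore] -/
theorem range_sliceEmbed_eq : range Minkowski.sliceEmbed = {x : E4 | x 0 = 0} :=
  Set.ext E4.mem_range_sliceEmbed_iff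

/-- The slice `{t = 0}` is closed in `E4`. [folklore] -/
theorem isClosed_range_sliceEmbed : IsClosed (range Minkowski.sliceEmbed) := by
  rw [range_sliceEmbed_eq]
  exact isClosed_eq ((EuclideanSpace.proj (0 : Fin 4)).continuous) continuous_const

/-- Hence `closure {t = 0} = {t = 0}`. [folklore] -/
theorem closure_range_sliceEmbed : closure (range Minkowski.sliceEmbed) = range Minkowski.sliceEmbed :=
  isClosed_range_sliceEmbed.closure_eq

/-- The slice `{t = 0}` of Minkowski spacetime is acausal: along a future causal curve the time
coordinate is STRICTLY increasing (`Minkowski.strictMonoOn_time_of_isFutureCausalCurveOn`), so a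
causal curve cannot start and end on `{t = 0}`. [cite: ONeillSemiRiemannian1983, Ch. 14, p. 415] -/
theorem isAcausal_range_sliceEmbed :
    LorentzianMetric.IsAcausal η₄ ∂ₜ (range Minkowski.sliceEmbed) := by
  intro p hp q hq γ a b hab hγ hγa hγb
  rw [E4.mem_range_sliceEmbed_iff] at hp hq
  have hlt : γ a 0 < γ b 0 := Minkowski.strictMonoOn_time_of_isFutureCausalCurveOn
    ordConnected_Icc hγ (left_mem_Icc.2 hab.le) (right_mem_Icc.2 hab.le) hab
  rw [hγa, hγb, hp, hq] at hlt
  exact lt_irrefl _ hlt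

/-- The slice embedding is `C^k` for every `k` (it is a linear map composed with the inclusion of
the open set `slice ⊆ E3`). [folklore] -/
theorem contMDiff_sliceEmbed (k : ℕ∞ω) :
    ContMDiff 𝓘(ℝ, E3) 𝓘(ℝ, E4) k Minkowski.sliceEmbed := by
  set L : E3 →L[ℝ] E4 :=
    LinearMap.toContinuousLinearMap (IsLinearMap.mk' _ Minkowski.isLinearMap_ofTimeSpace_zero)
  have h : Minkowski.sliceEmbed = (L : E3 → E4) ∘ Subtype.val := rfl
  rw [h]
  exact L.contMDiff.comp contMDiff_subtype_val

/-- The slice `{t = 0}` is spacelike: the induced form is `δ` (`pullbackBilin_sliceEmbed_holds`),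
positive definite. [cite: HawkingEllis1973, §5.1] -/
theorem isSpacelikeImmersion_sliceEmbed :
    (η₄).toPseudoRiemannianMetric.IsSpacelikeImmersion 𝓘(ℝ, E3) Minkowski.sliceEmbed := by
  refine ⟨contMDiff_sliceEmbed _, fun y v hv ↦ ?_⟩
  have h := congrArg (fun B ↦ B v v) (Minkowski.pullbackBilin_sliceEmbed_holds y)
  change pullbackBilin (I := 𝓘(ℝ, E4)) (I' := 𝓘(ℝ, E3)) Minkowski.sliceEmbed
    Minkowski.smoothMetric.val y v v = trivialData.h.inner y v v at h
  change 0 < pullbackBilin (I := 𝓘(ℝ, E4)) (I' := 𝓘(ℝ, E3)) Minkowski.sliceEmbed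
    Minkowski.smoothMetric.val y v v
  rw [h, trivialData_h_inner]
  have hv' : (show E3 from v) ≠ (0 : E3) := fun h0 ↦ hv h0
  change 0 < @inner ℝ E3 _ (show E3 from v) (show E3 from v)
  exact real_inner_self_pos.mpr hv'

/-! ## `{t = 0}` as a topological manifold with (empty) boundary -/

section HalfSpaceChart

/-- Half-space coordinates of a point of `E4`: `(e^{x¹}, x², x³)` (first coordinate `> 0`). [folklore] -/
def halfSpaceCoords (x : E4) : EuclideanSpace ℝ (Fin 3) :=
  WithLp.toLp 2 fun i ↦ Fin.cases (Real.exp (x 1)) (fun j ↦ x j.succ.succ) i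

/-- Inverse half-space coordinates: `(w⁰, w¹, w²) ↦ (0, log w⁰, w¹, w²)`. [folklore] -/
def halfSpaceInv (w : EuclideanSpace ℝ (Fin 3)) : E4 :=
  E4.ofTimeSpace 0 (WithLp.toLp 2 fun i ↦ Fin.cases (Real.log (w 0)) (fun j ↦ w j.succ) i)

/-- First half-space coordinate: `e^{x¹}`. [folklore] -/
@[simp] theorem halfSpaceCoords_zero (x : E4) : halfSpaceCoords x 0 = Real.exp (x 1) := rfl

/-- The other half-space coordinates: `x²`, `x³`. [folklore] -/
@[simp] theorem halfSpaceCoords_succ (x : E4) (j : Fin 2) :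
    halfSpaceCoords x j.succ = x j.succ.succ := rfl

/-- The inverse coordinates land on `{x⁰ = 0}`. [folklore] -/
@[simp] theorem halfSpaceInv_zero (w : EuclideanSpace ℝ (Fin 3)) : halfSpaceInv w 0 = 0 := rfl

/-- `x¹ = log w⁰` under the inverse coordinates. [folklore] -/
theorem halfSpaceInv_one (w : EuclideanSpace ℝ (Fin 3)) : halfSpaceInv w 1 = Real.log (w 0) := rfl

/-- The spatial components of the inverse coordinates. [folklore] -/
@[simp] theorem halfSpaceInv_succ (w : EuclideanSpace ℝ (Fin 3)) (j : Fin 3) :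
    halfSpaceInv w j.succ = Fin.cases (Real.log (w 0)) (fun k ↦ w k.succ) j := by
  rw [halfSpaceInv, E4.ofTimeSpace_apply_succ]

/-- The half-space coordinates are continuous. [folklore] -/
theorem continuous_halfSpaceCoords : Continuous halfSpaceCoords := by
  change Continuous ((EuclideanSpace.equiv (Fin 3) ℝ).symm ∘
    fun (x : E4) (i : Fin 3) ↦ Fin.cases (Real.exp (x 1)) (fun j ↦ x j.succ.succ) i)
  refine (EuclideanSpace.equiv (Fin 3) ℝ).symm.continuous.comp (continuous_pi fun i ↦ ?_)
  refine Fin.cases ?_ (fun j ↦ ?_) i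
  · exact Real.continuous_exp.comp (EuclideanSpace.proj (1 : Fin 4)).continuous
  · exact (EuclideanSpace.proj (j.succ.succ : Fin 4)).continuous

/-- The inverse coordinates are continuous on `{w⁰ > 0}`. [folklore] -/
theorem continuousOn_halfSpaceInv : ContinuousOn halfSpaceInv {w | 0 < w 0} := by
  change ContinuousOn (E4.ofTimeSpace 0 ∘ (EuclideanSpace.equiv (Fin 3) ℝ).symm ∘
    fun (w : EuclideanSpace ℝ (Fin 3)) (i : Fin 3) ↦
      Fin.cases (Real.log (w 0)) (fun j ↦ w j.succ) i) {w | 0 < w 0}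
  refine (E4.continuous_ofTimeSpace 0).comp_continuousOn
    ((EuclideanSpace.equiv (Fin 3) ℝ).symm.continuous.comp_continuousOn
      (continuousOn_pi.mpr fun i ↦ ?_))
  refine Fin.cases ?_ (fun j ↦ ?_) i
  · exact Real.continuousOn_log.comp (EuclideanSpace.proj (0 : Fin 3)).continuous.continuousOn
      fun w hw ↦ ne_of_gt hw
  · exact (EuclideanSpace.proj (j.succ : Fin 3)).continuous.continuousOn

/-- `halfSpaceInv ∘ halfSpaceCoords = id` on the slice `{x⁰ = 0}`. [folklore] -/
theorem halfSpaceInv_halfSpaceCoords {x : E4} (hx : x 0 = 0) :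
    halfSpaceInv (halfSpaceCoords x) = x := by
  ext i
  refine Fin.cases ?_ (fun j ↦ ?_) i
  · rw [halfSpaceInv_zero, hx]
  · rw [halfSpaceInv_succ]
    refine Fin.cases ?_ (fun k ↦ ?_) j
    · simp only [Fin.cases_zero, halfSpaceCoords_zero, Real.log_exp]
      rfl
    · simp only [Fin.cases_succ, halfSpaceCoords_succ]

/-- `halfSpaceCoords ∘ halfSpaceInv = id` on `{w⁰ > 0}`. [folklore] -/
theorem halfSpaceCoords_halfSpaceInv {w : EuclideanSpace ℝ (Fin 3)} (hw : 0 < w 0) :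
    halfSpaceCoords (halfSpaceInv w) = w := by
  ext i
  refine Fin.cases ?_ (fun j ↦ ?_) i
  · rw [halfSpaceCoords_zero, halfSpaceInv_one, Real.exp_log hw]
  · rw [halfSpaceCoords_succ, halfSpaceInv_succ]
    rfl

/-- `halfSpaceInv` takes values in the slice. [folklore] -/
theorem halfSpaceInv_mem (w : EuclideanSpace ℝ (Fin 3)) :
    halfSpaceInv w ∈ closure (range Minkowski.sliceEmbed) :=
  subset_closure ⟨⟨_, Minkowski.mem_slice _⟩, rfl⟩

/-- The global half-space chart of the closed slice `S̄ = {x⁰ = 0}`: `x ↦ (e^{x¹}, x², x³)`,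
onto the open subset `{w⁰ > 0}` of the half-space `{w⁰ ≥ 0}`. [folklore] -/
def halfSpaceChart :
    OpenPartialHomeomorph (closure (range Minkowski.sliceEmbed)) (EuclideanHalfSpace 3) where
  toFun z := ⟨halfSpaceCoords z.1, (Real.exp_pos _).le⟩
  invFun w := ⟨halfSpaceInv w.1, halfSpaceInv_mem w.1⟩
  source := univ
  target := {w | 0 < w.1 0}
  map_source' z _ := Real.exp_pos _
  map_target' _ _ := mem_univ _
  left_inv' z _ := by
    have hz : (z : E4) 0 = 0 :=
      (E4.mem_range_sliceEmbed_iff _).mp (isClosed_range_sliceEmbed.closure_subset z.2)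
    exact Subtype.ext (halfSpaceInv_halfSpaceCoords hz)
  right_inv' w hw := Subtype.ext (halfSpaceCoords_halfSpaceInv hw)
  open_source := isOpen_univ
  open_target := isOpen_lt continuous_const
    ((EuclideanSpace.proj (0 : Fin 3)).continuous.comp continuous_subtype_val)
  continuousOn_toFun :=
    ((continuous_halfSpaceCoords.comp continuous_subtype_val).subtype_mk _).continuousOn
  continuousOn_invFun := by
    rw [Topology.IsInducing.subtypeVal.continuousOn_iff]
    exact continuousOn_halfSpaceInv.comp continuous_subtype_val.continuousOn fun w hw ↦ hw

/-- The `C⁰` half-space atlas `{halfSpaceChart}` of the closed slice. [folklore] -/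
@[reducible] def halfSpaceChartedSpace :
    ChartedSpace (EuclideanHalfSpace 3) (closure (range Minkowski.sliceEmbed)) where
  atlas := {halfSpaceChart}
  chartAt _ := halfSpaceChart
  mem_chart_source _ := mem_univ _
  chart_mem_atlas _ := mem_singleton _

/-- In the half-space atlas the closed slice has NO boundary point (every chart value has first
coordinate `e^{x¹} > 0`, off the model boundary `{w⁰ = 0}`). [folklore] -/
theorem boundary_halfSpace_eq_empty :
    @ModelWithCorners.boundary ℝ _ _ _ _ _ _ (𝓡∂ 3) (closure (range Minkowski.sliceEmbed)) _
      halfSpaceChartedSpace = ∅ := by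
  letI := halfSpaceChartedSpace
  ext z
  simp only [mem_empty_iff_false, iff_false]
  intro hz
  change (𝓡∂ 3).IsBoundaryPoint z at hz
  rw [ModelWithCorners.isBoundaryPoint_iff, frontier_range_modelWithCornersEuclideanHalfSpace]
    at hz
  have h : (extChartAt (𝓡∂ 3) z z) 0 = Real.exp ((z : E4) 1) := rfl
  simp only [mem_setOf_eq] at hz
  rw [h] at hz
  exact (Real.exp_pos _).ne hz

end HalfSpaceChart


/-! ## The `I⁺`-regular hypersurface `{t = 0}` of the Minkowski presentation -/

section Hypersurface

/-- The compact part of `S̄ = {t = 0}`: the embedded closed unit ball. [folklore] -/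
theorem isCompact_sliceBall :
    IsCompact (E4.ofTimeSpace 0 '' Metric.closedBall (0 : E3) 1) :=
  (isCompact_closedBall (0 : E3) 1).image (E4.continuous_ofTimeSpace 0)

/-- `S̄ = {t = 0}` is the union of the embedded closed unit ball and of the end `{‖y‖ > 1}`. [folklore] -/
theorem closure_range_sliceEmbed_eq_union :
    closure (range Minkowski.sliceEmbed) =
      E4.ofTimeSpace 0 '' Metric.closedBall (0 : E3) 1 ∪
        ⋃ _i : Fin 1, Minkowski.sliceEmbed '' ((trivialAFEnd.U : TopologicalSpace.Opens Minkowski.slice) :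
          Set Minkowski.slice) := by
  rw [closure_range_sliceEmbed, Set.iUnion_const]
  ext x
  rw [E4.mem_range_sliceEmbed_iff]
  constructor
  · intro hx
    have hxe : E4.ofTimeSpace 0 (E4.spatial x) = x := by
      have h := E4.ofTimeSpace_time_spatial x
      rwa [E4.time_apply, hx] at h
    rcases le_or_gt ‖E4.spatial x‖ 1 with h1 | h1
    · exact Or.inl ⟨E4.spatial x, Metric.mem_closedBall.mpr (by simpa using h1), hxe⟩
    · refine Or.inr ⟨⟨E4.spatial x, Minkowski.mem_slice _⟩, ?_, hxe⟩
      change trivialAFEnd.R < ‖E4.spatial x‖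
      rwa [trivialAFEnd_R]
  · rintro (⟨y, -, rfl⟩ | ⟨y, -, rfl⟩)
    · rfl
    · rfl

/-- **The slice `{t = 0}` is a hypersurface as in Chruściel–Costa's Definition 1.1 for the
Minkowski presentation** `minkowskiBH`: spacelike, connected, acausal, inside the d.o.c. `= ℝ⁴`,
containing the far region of the end, with the trivial induced data (AF of order `1`), closed (so
`∂S̄ = ∅`, a cross-section of the EMPTY horizon), the union of the compact unit ball and the end
`{‖y‖ > 1}`, and a topological manifold WITHOUT boundary in the half-space atlas.
[cite: ChruscielCosta2008, Def. 1.1] -/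
def minkowskiHypersurface : minkowskiBH.IPlusRegularHypersurface where
  N := Minkowski.slice
  f := Minkowski.sliceEmbed
  normal := Minkowski.sliceNormal
  D := trivialData
  numEnds := 1
  ends := fun _ ↦ trivialAFEnd
  K := E4.ofTimeSpace 0 '' Metric.closedBall (0 : E3) 1
  chartedSpaceClosure := halfSpaceChartedSpace
  isSmoothEmbedding := Minkowski.isSmoothEmbedding_sliceEmbed_holds
  isSpacelike := isSpacelikeImmersion_sliceEmbed
  isConnected := isConnected_range Minkowski.continuous_sliceEmbed
  isAcausal := isAcausal_range_sliceEmbed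
  range_subset_doc := by rw [doc_minkowskiBH]; exact subset_univ _
  image_far_subset_range := image_subset_range _ _
  isFutureUnitNormal := Minkowski.isFutureUnitNormal_sliceNormal_holds
  induced_h := Minkowski.pullbackBilin_sliceEmbed_holds
  induced_k := by
    intro hLC y
    haveI : Minkowski.smoothMetric.toPseudoRiemannianMetric.HasLeviCivita := hLC
    exact Minkowski.secondFundamentalForm_sliceEmbed_holds y
  isAsymptoticallyFlat := fun _ ↦ ⟨1, one_pos,
    AFEnd.IsStronglyAsymptoticallyFlatDR.IsAsymptoticallyFlat_one_holds trivialAFEnd trivialData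
      trivialAFEnd_isStronglyAsymptoticallyFlatCK_holds.isStronglyAsymptoticallyFlatDR⟩
  isCompact_K := isCompact_sliceBall
  closure_eq := closure_range_sliceEmbed_eq_union
  boundary_eq := by
    ext z
    constructor
    · -- the half-space atlas has no boundary point
      intro hz
      exact absurd ((congrArg (fun S ↦ z ∈ S) boundary_halfSpace_eq_empty).mp hz)
        (Set.notMem_empty z)
    · intro hz
      exact absurd (isClosed_range_sliceEmbed.closure_subset hz.1) hz.2
  boundary_subset_horizon := fun x hx ↦
    absurd (isClosed_range_sliceEmbed.closure_subset hx.1) hx.2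
  isCrossSection := by
    intro _
    refine ⟨fun x hx ↦ absurd (isClosed_range_sliceEmbed.closure_subset hx.1) hx.2, ?_⟩
    · intro γ s hγ
      exfalso
      obtain ⟨t, ht, -⟩ := hγ.2.1
      have hmem : γ t ∈ minkowskiBH.horizon := hγ.1.2.2.2 ht
      rw [horizon_minkowskiBH] at hmem
      exact hmem

/-- **The Minkowski presentation is `I⁺`-regular** (Chruściel–Costa Def. 1.1): `∂ₜ` is complete,
the d.o.c. `ℝ⁴` is a globally hyperbolic set (Minkowski spacetime is strongly causal with compact
causal diamonds), and `{t = 0}` is a hypersurface as in Def. 1.1. [cite: ChruscielCosta2008, Def. 1.1] -/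
theorem isIPlusRegular_minkowskiBH : minkowskiBH.IsIPlusRegular := by
  refine ⟨isCompleteVectorField_timeField, ⟨fun p _ ↦ ?_, fun p _ q _ ↦ ⟨?_, ?_⟩⟩,
    ⟨minkowskiHypersurface⟩⟩
  · exact minkowski_isStronglyCausalAt p
  · exact Minkowski.isCompact_causalFuture_inter_causalPast p q
  · rw [doc_minkowskiBH]; exact subset_univ _

/-- **The Minkowski presentation is analytic** (`IsAnalytic`: analytic atlas, and the metric is the
`C^∞` lowering of the analytic Minkowski metric `Minkowski.metric`). [folklore] -/
theorem isAnalytic_minkowskiBH : minkowskiBH.IsAnalytic :=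
  ⟨inferInstanceAs (IsManifold 𝓘(ℝ, E4) ω E4), Minkowski.metric, rfl⟩

end Hypersurface

end Summit.FinalStateConjecture.FinalStateConjecture.Theorems.ZeroEnergyRigidity.Negative

end
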